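import Literature.NumberTheory.EllipticCurves.WeierstrassZWChart
import Mathlib.RingTheory.PolynomialAlgebra
import HarnessLib

/-!
# The coordinate rings of the two charts of a Weierstrass cubic: base change and integrality

Commutative algebra of the two affine charts `U₁ = Spec R[W]` (Mathlib's
`WeierstrassCurve.Affine.CoordinateRing`) and `U₂ = Spec R[W]_O`
(`WeierstrassCurve.ZWCoordinateRing`, Silverman's `(z, w)`-chart at `O`, AEC IV.1) of the
Weierstrass cubic `E_W`, needed to show that `E_W` is geometrically integral and that its
self-products are reduced:

* **base change**: for an `R`-algebra `S`, `S ⊗[R] R[W] ≃ₐ[S] S[W_S]` and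
  `S ⊗[R] R[W]_O ≃ₐ[S] S[W_S]_O` where `W_S = W.baseChange S`
  (`CoordinateRing.baseChangeEquiv`, `ZWCoordinateRing.baseChangeEquiv`), deduced from a
  general statement for quotients of bivariate polynomial rings
  (`AdjoinRoot.bivariateBaseChangeEquiv`: `S ⊗[R] R[X][Y]/(p) ≃ₐ[S] S[X][Y]/(p_S)`), itself
  Mathlib's `AdjoinRoot.tensorAlgEquiv` composed with `polyEquivTensor`;
* **integrality of the chart at `O`**: `w` is a non-zero-divisor of `R[W]_O` for every `R`
  (`wClass_mem_nonZeroDivisors`: `R[W]_O` is free over `R[w]` and `w` acts through the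
  non-zero-divisor `X ∈ R[w]`), hence `R[W]_O ↪ R[W]_O[1/w] ≅ R[W][1/y]`, and for `R` a domain
  `R[W]` is a domain (Mathlib), so are its localisation `R[W][1/y]` and therefore `R[W]_O`
  (`ZWCoordinateRing.instIsDomain`); in particular both charts of `E_W` and their overlap are
  integral for every Weierstrass equation over a domain (no smoothness needed: the Weierstrass
  cubic is always irreducible, AEC III.1, cf. Mathlib's `irreducible_polynomial`).

## References

* [SilvermanAEC2009] J. H. Silverman, *The Arithmetic of Elliptic Curves*, 2nd ed., GTM 106,
  Springer 2009, III.1 (the Weierstrass cubic is irreducible), IV.1 (the chart at `O`).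

## Design

* The base-change isomorphisms are `S`-algebra isomorphisms and are pinned down by their
  values on the generators (`…_tmul_xClass`, `…_tmul_yClass`, `…_tmul_zClass`, `…_tmul_wClass`).
* Declarations about Mathlib's `CoordinateRing` are deliberate dot-notation extensions in
  `namespace WeierstrassCurve.Affine.CoordinateRing`; the general lemma is a deliberate
  extension of `namespace AdjoinRoot`.
-/

noncomputable section

open Polynomial TensorProduct
open scoped Polynomial.Bivariate

universe u v

/-! ## Base change of quotients of bivariate polynomial rings -/

namespace AdjoinRoot

variable (R : Type u) (S : Type v) [CommRing R] [CommRing S] [Algebra R S] (p : R[X][Y])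

/-- The base change `R[X] → S ⊗[R] R[X] ≅ S[X]` of the coefficient ring is `Polynomial.map`.
[folklore] -/
theorem polyEquivTensor'_symm_comp_includeRight :
    (RingHomClass.toRingHom ((polyEquivTensor' R S).symm : S ⊗[R] R[X] ≃ₐ[S] S[X])).comp
        (Algebra.TensorProduct.includeRight (R := R) (A := S) (B := R[X])).toRingHom =
      mapRingHom (algebraMap R S) := by
  refine RingHom.ext fun q ↦ ?_
  change (polyEquivTensor R S).symm ((1 : S) ⊗ₜ[R] q) = q.map (algebraMap R S)
  rw [polyEquivTensor_symm_apply_tmul_eq_smul, one_smul]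

/-- **Adjoining a root of a bivariate polynomial commutes with base change**: for
`p ∈ R[X][Y]` and an `R`-algebra `S`, `S ⊗[R] (R[X][Y]/(p)) ≃ₐ[S] S[X][Y]/(p_S)` where `p_S` is
the image of `p`. (Mathlib's `AdjoinRoot.tensorAlgEquiv` over the coefficient ring `R[X]`,
followed by `S ⊗[R] R[X] ≅ S[X]`.) [folklore] -/
def bivariateBaseChangeEquiv :
    S ⊗[R] AdjoinRoot p ≃ₐ[S] AdjoinRoot (p.map (mapRingHom (algebraMap R S))) :=
  (tensorAlgEquiv (R := R) (T := S) p _ rfl).trans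
    (mapAlgEquiv (polyEquivTensor' R S).symm _ _ <| .of_eq <| by
      rw [Polynomial.map_map]
      exact congrArg (fun φ ↦ p.map φ) (polyEquivTensor'_symm_comp_includeRight R S))

/-- The base-change isomorphism sends `1 ⊗ ȳ` (the class of the outer variable) to `ȳ`.
[folklore] -/
@[simp]
theorem bivariateBaseChangeEquiv_tmul_root :
    bivariateBaseChangeEquiv R S p (1 ⊗ₜ root p) = root _ := by
  simp only [bivariateBaseChangeEquiv, AlgEquiv.trans_apply, tensorAlgEquiv_root, coe_mapAlgEquiv,
    map_root]

/-- The base-change isomorphism sends `1 ⊗ q̄` to the class of `q` mapped to `S[X]`, for `q` in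
the coefficient ring `R[X]`. [folklore] -/
@[simp]
theorem bivariateBaseChangeEquiv_tmul_of (q : R[X]) :
    bivariateBaseChangeEquiv R S p (1 ⊗ₜ of p q) = of _ (q.map (algebraMap R S)) := by
  simp only [bivariateBaseChangeEquiv, AlgEquiv.trans_apply, tensorAlgEquiv_of, coe_mapAlgEquiv,
    map_of]
  congr 1
  exact congrArg (fun φ : R[X] →+* S[X] ↦ φ q) (polyEquivTensor'_symm_comp_includeRight R S)

/-- The base-change isomorphism is `S`-linear: `s ⊗ 1 ↦ s`. [folklore] -/
theorem bivariateBaseChangeEquiv_tmul_one (s : S) :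
    bivariateBaseChangeEquiv R S p (s ⊗ₜ 1) = algebraMap S _ s := by
  rw [show s ⊗ₜ[R] (1 : AdjoinRoot p) = s • (1 : S ⊗[R] AdjoinRoot p) by
      rw [Algebra.TensorProduct.one_def, TensorProduct.smul_tmul', smul_eq_mul, mul_one],
    map_smul, map_one, Algebra.algebraMap_eq_smul_one]

end AdjoinRoot

namespace WeierstrassCurve

variable {R : Type u} [CommRing R] (W : WeierstrassCurve R) (S : Type u) [CommRing S]
  [Algebra R S]

/-! ## Base change of the affine chart -/

namespace Affine.CoordinateRing

/-- **The affine coordinate ring commutes with base change**: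
`S ⊗[R] R[W] ≃ₐ[S] S[W_S]`, `W_S = W.baseChange S` (the affine Weierstrass curve of `W` over
`S` is the base change of the one over `R`). Deliberate dot-notation extension of Mathlib's
`WeierstrassCurve.Affine.CoordinateRing`. [folklore] -/
def baseChangeEquiv :
    S ⊗[R] W.toAffine.CoordinateRing ≃ₐ[S] (W.baseChange S).toAffine.CoordinateRing :=
  (AdjoinRoot.bivariateBaseChangeEquiv R S W.toAffine.polynomial).trans
    (AdjoinRoot.algEquivOfEq S _ _ (Affine.map_polynomial W.toAffine (algebraMap R S)).symm)

/-- `1 ⊗ y ↦ y`. [folklore] -/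
@[simp]
theorem baseChangeEquiv_tmul_yClass :
    baseChangeEquiv W S (1 ⊗ₜ yClass W) = yClass (W.baseChange S) := by
  simp [baseChangeEquiv, yClass, AdjoinRoot.algEquivOfEq]

/-- `1 ⊗ x ↦ x`. [folklore] -/
@[simp]
theorem baseChangeEquiv_tmul_xClass :
    baseChangeEquiv W S (1 ⊗ₜ xClass W) = xClass (W.baseChange S) := by
  simp [baseChangeEquiv, xClass, AdjoinRoot.algEquivOfEq, AdjoinRoot.coe_algEquivOfAssociated,
    AdjoinRoot.coe_algHomOfDvd, Algebra.ofId_apply]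

/-- `s ⊗ 1 ↦ s`. [folklore] -/
theorem baseChangeEquiv_tmul_one (s : S) :
    baseChangeEquiv W S (s ⊗ₜ 1) = algebraMap S _ s := by
  simp [baseChangeEquiv, AdjoinRoot.bivariateBaseChangeEquiv_tmul_one]

end Affine.CoordinateRing

/-! ## Base change of the chart at `O` -/

namespace ZWCoordinateRing

/-- **The chart at `O` commutes with base change**: `S ⊗[R] R[W]_O ≃ₐ[S] S[W_S]_O`,
`W_S = W.baseChange S`. [folklore] -/
def baseChangeEquiv : S ⊗[R] W.ZWCoordinateRing ≃ₐ[S] (W.baseChange S).ZWCoordinateRing :=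
  (AdjoinRoot.bivariateBaseChangeEquiv R S W.zwPolynomial).trans
    (AdjoinRoot.algEquivOfEq S _ _ (W.map_zwPolynomial (algebraMap R S)).symm)

/-- `1 ⊗ z ↦ z`. [folklore] -/
@[simp]
theorem baseChangeEquiv_tmul_zClass :
    baseChangeEquiv W S (1 ⊗ₜ zClass W) = zClass (W.baseChange S) := by
  simp [baseChangeEquiv, zClass, AdjoinRoot.algEquivOfEq]

/-- `1 ⊗ w ↦ w`. [folklore] -/
@[simp]
theorem baseChangeEquiv_tmul_wClass :
    baseChangeEquiv W S (1 ⊗ₜ wClass W) = wClass (W.baseChange S) := by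
  simp [baseChangeEquiv, wClass, AdjoinRoot.algEquivOfEq, AdjoinRoot.coe_algEquivOfAssociated,
    AdjoinRoot.coe_algHomOfDvd, Algebra.ofId_apply]

/-- `s ⊗ 1 ↦ s`. [folklore] -/
theorem baseChangeEquiv_tmul_one (s : S) :
    baseChangeEquiv W S (s ⊗ₜ 1) = algebraMap S _ s := by
  simp [baseChangeEquiv, AdjoinRoot.bivariateBaseChangeEquiv_tmul_one]

/-! ## `w` is a non-zero-divisor; the chart at `O` is a domain -/

/-- Multiplication by `w` on `R[W]_O` is scalar multiplication by the variable of the base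
ring `R[w]`. [folklore] -/
theorem wClass_mul_eq_X_smul (m : W.ZWCoordinateRing) : wClass W * m = (X : R[X]) • m := by
  rw [Algebra.smul_def, AdjoinRoot.algebraMap_eq, wClass_eq_of]

/-- **`w` is a non-zero-divisor of `R[W]_O`** for every commutative ring `R`: `R[W]_O` is
free over `R[w]` (basis `1, z, z²`, the chart equation being monic in `z`) and `w` acts as
the non-zero-divisor `X` of `R[w]`. [folklore] -/
theorem wClass_mem_nonZeroDivisors : wClass W ∈ nonZeroDivisors W.ZWCoordinateRing := by
  refine mem_nonZeroDivisors_iff_right.mpr fun m hm ↦ ?_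
  rw [mul_comm, wClass_mul_eq_X_smul] at hm
  let b := (AdjoinRoot.powerBasis' W.monic_zwPolynomial).basis
  refine b.ext_elem fun i ↦ ?_
  have hi := congrArg (fun v ↦ b.repr v i) hm
  simp only [map_smul, Finsupp.smul_apply, smul_eq_mul, map_zero, Finsupp.zero_apply] at hi
  rw [map_zero, Finsupp.zero_apply]
  exact (isRegular_X (R := R)).left (hi.trans (mul_zero _).symm)

/-- The localisation map `R[W]_O → R[W]_O[1/w]` is injective (as `w` is a non-zero-divisor).
[folklore] -/
theorem algebraMap_awayW_injective :
    Function.Injective (algebraMap W.ZWCoordinateRing W.AwayW) :=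
  IsLocalization.injective W.AwayW
    ((Submonoid.powers_le (P := nonZeroDivisors _)).mpr (wClass_mem_nonZeroDivisors W))

/-- `zwToAway : R[W]_O → R[W][1/y]` (`z ↦ -x/y`, `w ↦ -1/y`) is injective: it is the injective
localisation map followed by the chart transition isomorphism. [cite: SilvermanAEC2009, IV.1] -/
theorem zwToAway_injective : Function.Injective W.zwToAway := by
  have h : W.zwToAway = (W.awayEquiv.symm : W.AwayW →+* W.AwayY).comp (algebraMap _ W.AwayW) :=
    RingHom.ext fun b ↦ (awayWToAwayY_algebraMap W b).symm
  rw [h, RingHom.coe_comp]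
  exact W.awayEquiv.symm.injective.comp (algebraMap_awayW_injective W)

end ZWCoordinateRing

section Domain

variable [IsDomain R]

/-- `y ≠ 0` in `R[W]` (for `R` nontrivial): `y` is a basis vector of `R[W]` over `R[x]`.
[folklore] -/
theorem yClass_ne_zero : yClass W ≠ 0 := by
  rw [yClass, ← Affine.CoordinateRing.basis_one]
  exact (Affine.CoordinateRing.basis W.toAffine).ne_zero 1

/-- Over a domain, the overlap ring `R[W][1/y]` is a domain (localisation of the domain `R[W]`,
Mathlib's `instIsDomainCoordinateRing`, at the non-zero element `y`). [folklore] -/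
instance instIsDomainAwayY : IsDomain W.AwayY :=
  IsLocalization.isDomain_localization
    (powers_le_nonZeroDivisors_of_noZeroDivisors (yClass_ne_zero W))

/-- **Over a domain the chart at `O` is integral**: `R[W]_O` embeds by `zwToAway` into the
domain `R[W][1/y]`. (The Weierstrass cubic is irreducible for every Weierstrass equation;
Silverman, *AEC* III.1; no smoothness is needed.) [cite: SilvermanAEC2009, III.1] -/
instance ZWCoordinateRing.instIsDomain : IsDomain W.ZWCoordinateRing :=
  (ZWCoordinateRing.zwToAway_injective W).isDomain W.zwToAway

/-- Over a domain, `R[W]_O[1/w] ≅ R[W][1/y]` is a domain. [folklore] -/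
instance instIsDomainAwayW : IsDomain W.AwayW :=
  W.awayEquiv.symm.injective.isDomain W.awayEquiv.symm.toRingHom

end Domain

end WeierstrassCurve
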